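import Summits.AtomisticToContinuum.HydrodynamicLimit.Theorems.TwoClocksEquilibriumFastWindowLDWindowExtension
import Summits.AtomisticToContinuum.HydrodynamicLimit.Theorems.TwoClocksEquilibriumFastWindowLDBirthLipschitzDualFamily
import Summits.AtomisticToContinuum.HydrodynamicLimit.Theorems.TwoClocksEquilibriumFastWindowLDBirthLipschitzApprox

/-!
# Stub `stub_lipschitzReduction` (L: `W_Lip → W`) of the line `birth` for the crux
`TwoClocks.EquilibriumFastWindowLD` (stmt-AtomisticToContinuum-14440)

STATIC reduction of the bounded-class normal form `W` of the crux (continuous `G` on `𝕋³ × ℝ³`,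
`|G(x,v)| ≤ C'(1+|v|²)`, compact `v`-support, `M_{1,u₀,θ₀}`-orthogonal at every `x` to
`1, v_j, |v|²`, CLASS-UNIFORM tilt range `β₁(C')`) to its restriction `W_Lip` to observables that
are moreover Lipschitz in `v` and in `x` with SOME constant (the tilt range still chosen before `G`).

Proof (density + Hölder, the architecture of `EquilibriumFastWindowLD_of_boundedWindowLD` and
`windowGood_of_approx`): given `C'`, take `β₁ = min (β₁^{Lip}(C'+1)/2) (t₁/2)` with `t₁` the
one-site Gaussian range at growth `1` (`stub_oneSiteGauss`). Given `G ∈ 𝒢(C')`, `|β| ≤ β₁`, `ε > 0`, choose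
`δ(β, ε) ≤ 1` and a Lipschitz `G' ∈ 𝒢_Lip(C'+1)` with `sup |G − G'| ≤ δ`
(`lipschitzReduction_approx`, with the Lipschitz dual family `lipschitzReduction_dualFamily` to
`1, v_j, |v|²`); split `G = G' + (G − G')` by Hölder with weight `½` (`stub_holderSplit`): the first
factor is `W_Lip` at tilt `2β`, the second is STATIC at every window (`stub_oneSiteGauss` applied to
the centred `(G − G')/δ` at tilt `2βδ`, then `stub_staticReduction`), `≤ e^{(ε/2)(N+1)}` by the
choice of `δ`. No dynamics.
-/

noncomputable section

open MeasureTheory ProbabilityTheory Real Set Filter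
open scoped ENNReal BigOperators

namespace Summit.AtomisticToContinuum.HydrodynamicLimit.Theorems.ClampedCorrectorBirth

open Literature.Analysis.FluidPDE Literature.MathematicalPhysics.KineticTheory
open Summit.AtomisticToContinuum.HydrodynamicLimit.Theorems.FastWindowRG

/-- The collision invariants `1, v₀, v₁, v₂, |v|²` as a family indexed by `Fin 5`: continuous,
Lipschitz on the ball of radius `2`, linearly independent on the unit ball. [folklore] -/
private theorem invariants_props (e : Fin 5 → V3 → ℝ)
    (he : e = ![fun _ => 1, fun v => v 0, fun v => v 1, fun v => v 2, fun v => ‖v‖ ^ 2]) :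
    (∀ i, Continuous (e i)) ∧
    (∃ Le : ℝ, ∀ i v v', ‖v‖ ≤ 2 → ‖v'‖ ≤ 2 → |e i v - e i v'| ≤ Le * ‖v - v'‖) ∧
    (∀ a : Fin 5 → ℝ, (∀ v : V3, ‖v‖ ≤ 1 → ∑ i, a i * e i v = 0) → a = 0) := by
  subst he
  have hcoord : ∀ (j : Fin 3) (v v' : V3), |v j - v' j| ≤ 4 * ‖v - v'‖ := fun j v v' => by
    rw [← PiLp.sub_apply, ← Real.norm_eq_abs]
    exact (PiLp.norm_apply_le (v - v') j).trans (by nlinarith [norm_nonneg (v - v')])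
  refine ⟨fun i => ?_, ⟨4, fun i v v' hv hv' => ?_⟩, fun a ha => ?_⟩
  · fin_cases i <;> simp <;> fun_prop
  · fin_cases i
    · simp
    · simpa using hcoord 0 v v'
    · simpa using hcoord 1 v v'
    · simpa using hcoord 2 v v'
    · simp only [Fin.reduceFinMk, Matrix.cons_val]
      rw [sq_sub_sq, abs_mul, abs_of_nonneg (by positivity : (0 : ℝ) ≤ ‖v‖ + ‖v'‖)]
      calc (‖v‖ + ‖v'‖) * |‖v‖ - ‖v'‖| ≤ 4 * ‖v - v'‖ :=
            mul_le_mul (by linarith) (abs_norm_sub_norm_le v v') (abs_nonneg _) (by norm_num)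
        _ = 4 * ‖v - v'‖ := rfl
  · have h0 := ha 0 (by simp)
    simp [Fin.sum_univ_five] at h0
    have hE : ∀ j : Fin 3, ‖(EuclideanSpace.single j (1 : ℝ) : V3)‖ ≤ 1 := fun j => by
      rw [PiLp.norm_single]; simp
    have hE' : ∀ j : Fin 3, ‖(-EuclideanSpace.single j (1 : ℝ) : V3)‖ ≤ 1 := fun j => by
      rw [norm_neg]; exact hE j
    have hp0 := ha _ (hE 0); have hp1 := ha _ (hE 1); have hp2 := ha _ (hE 2)
    have hm0 := ha _ (hE' 0); have hm1 := ha _ (hE' 1); have hm2 := ha _ (hE' 2)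
    simp [Fin.sum_univ_five] at hp0 hp1 hp2 hm0 hm1 hm2
    funext i
    fin_cases i <;> simp <;> linarith

/-- Orthogonality to the indexed family `1, v₀, v₁, v₂, |v|²` is the conjunction of the three
orthogonality clauses of the crux. [folklore] -/
private theorem orth_iff (e : Fin 5 → V3 → ℝ)
    (he : e = ![fun _ => 1, fun v => v 0, fun v => v 1, fun v => v 2, fun v => ‖v‖ ^ 2])
    (M : V3 → ℝ) (F : V3 → ℝ) :
    (∀ l, ∫ v, F v * e l v * M v = 0) ↔
      (∫ v, F v * M v = 0) ∧ (∀ j : Fin 3, ∫ v, F v * v j * M v = 0) ∧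
        (∫ v, F v * ‖v‖ ^ 2 * M v = 0) := by
  subst he
  constructor
  · intro h
    refine ⟨by simpa using h 0, fun j => ?_, by simpa using h 4⟩
    fin_cases j
    · simpa using h 1
    · simpa using h 2
    · simpa using h 3
  · rintro ⟨h0, h1, h2⟩ l
    fin_cases l
    · simpa using h0
    · simpa using h1 0
    · simpa using h1 1
    · simpa using h1 2
    · simpa using h2

/-- A continuous function on `ℝ³` vanishing off a ball is integrable. [folklore] -/
private theorem integrable_of_vanish_ball {φ : V3 → ℝ} (hφ : Continuous φ) (T : ℝ)
    (hT : ∀ v, T ≤ ‖v‖ → φ v = 0) : Integrable φ :=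
  hφ.integrable_of_hasCompactSupport (HasCompactSupport.intro (isCompact_closedBall (0 : V3) T)
    fun v hv => hT v (by rw [Metric.mem_closedBall, dist_zero_right, not_le] at hv; exact hv.le))

/-- **L `stub_lipschitzReduction`** (`W_Lip → W`, statics). The bounded-class normal form of the
crux with a class-uniform tilt range follows from its restriction to `(x, v)`-Lipschitz observables:
Lipschitz approximation inside the class (`lipschitzReduction_approx` with the Lipschitz dual family
`lipschitzReduction_dualFamily`), Hölder split with weight `½` (`stub_holderSplit`), the Lipschitz
part by hypothesis at tilt `2β`, the uniformly small centred remainder statically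
(`stub_oneSiteGauss` at growth `1`, `stub_staticReduction`). -/
theorem stub_lipschitzReduction : (∃ σ₀ : ℝ, 0 < σ₀ ∧ ∀ (a₀ θ₀ : ℝ) (u₀ : V3), 0 < a₀ → 0 < θ₀ → ∀ σ : ℝ, 0 < σ → σ < σ₀ →
      ∀ Φ : (N : ℕ) → HardSphereFlow (Torus.geometry (Fin 3)) (hsDiameter σ N) (N + 1),
      ∀ C' : ℝ, 0 ≤ C' → ∃ β₁ : ℝ, 0 < β₁ ∧
      ∀ G : T3 × V3 → ℝ, Continuous G → (∀ y, |G y| ≤ C' * (1 + ‖y.2‖ ^ 2)) →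
      (∃ R : ℝ, ∀ y : T3 × V3, R ≤ ‖y.2‖ → G y = 0) →
      (∃ L' : ℝ, (∀ x v v', |G (x, v) - G (x, v')| ≤ L' * ‖v - v'‖ * (1 + ‖v‖ + ‖v'‖)) ∧
        (∀ x x' v, |G (x, v) - G (x', v)| ≤ L' * (1 + ‖v‖ ^ 2) * dist x x')) →
      (∀ x, ∫ v, G (x, v) * localMaxwellian 1 θ₀ u₀ v = 0) →
      (∀ x (j : Fin 3), ∫ v, G (x, v) * v j * localMaxwellian 1 θ₀ u₀ v = 0) →
      (∀ x, ∫ v, G (x, v) * ‖v‖ ^ 2 * localMaxwellian 1 θ₀ u₀ v = 0) →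
      ∀ β : ℝ, |β| ≤ β₁ → ∀ ε : ℝ, 0 < ε → ∃ τ : ℝ, 0 < τ ∧ ∃ N₀ : ℕ, ∀ N : ℕ, N₀ ≤ N →
        ∫⁻ z, ENNReal.ofReal (Real.exp (β * ∑ i : Fin (N + 1),
            (τ * ((N : ℝ) + 1) ^ (-(1 / 3 : ℝ)))⁻¹ *
              ∫ r in (0 : ℝ)..(τ * ((N : ℝ) + 1) ^ (-(1 / 3 : ℝ))), G (((Φ N).flow r z) i)))
          ∂(localGibbsLaw σ (fun _ => a₀) (fun _ => u₀) (fun _ => θ₀) N (Φ N)) ≤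
          ENNReal.ofReal (Real.exp (ε * ((N : ℝ) + 1)))) →
    (∃ σ₀ : ℝ, 0 < σ₀ ∧ ∀ (a₀ θ₀ : ℝ) (u₀ : V3), 0 < a₀ → 0 < θ₀ → ∀ σ : ℝ, 0 < σ → σ < σ₀ →
      ∀ Φ : (N : ℕ) → HardSphereFlow (Torus.geometry (Fin 3)) (hsDiameter σ N) (N + 1),
      ∀ C' : ℝ, 0 ≤ C' → ∃ β₁ : ℝ, 0 < β₁ ∧
      ∀ G : T3 × V3 → ℝ, Continuous G → (∀ y, |G y| ≤ C' * (1 + ‖y.2‖ ^ 2)) →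
      (∃ R : ℝ, ∀ y : T3 × V3, R ≤ ‖y.2‖ → G y = 0) →
      (∀ x, ∫ v, G (x, v) * localMaxwellian 1 θ₀ u₀ v = 0) →
      (∀ x (j : Fin 3), ∫ v, G (x, v) * v j * localMaxwellian 1 θ₀ u₀ v = 0) →
      (∀ x, ∫ v, G (x, v) * ‖v‖ ^ 2 * localMaxwellian 1 θ₀ u₀ v = 0) →
      ∀ β : ℝ, |β| ≤ β₁ → ∀ ε : ℝ, 0 < ε → ∃ τ : ℝ, 0 < τ ∧ ∃ N₀ : ℕ, ∀ N : ℕ, N₀ ≤ N →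
        ∫⁻ z, ENNReal.ofReal (Real.exp (β * ∑ i : Fin (N + 1),
            (τ * ((N : ℝ) + 1) ^ (-(1 / 3 : ℝ)))⁻¹ *
              ∫ r in (0 : ℝ)..(τ * ((N : ℝ) + 1) ^ (-(1 / 3 : ℝ))), G (((Φ N).flow r z) i)))
          ∂(localGibbsLaw σ (fun _ => a₀) (fun _ => u₀) (fun _ => θ₀) N (Φ N)) ≤
          ENNReal.ofReal (Real.exp (ε * ((N : ℝ) + 1)))) := by
  intro hW
  obtain ⟨σ₀, hσ₀, hWσ⟩ := hW
  refine ⟨min σ₀ (1 / 2), lt_min hσ₀ (by norm_num), ?_⟩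
  intro a₀ θ₀ u₀ ha hθ σ hσ hσlt Φ C' hC'
  have hσ₀' : σ < σ₀ := hσlt.trans_le (min_le_left _ _)
  have hσ2 : σ ≤ 1 / 2 := (hσlt.trans_le (min_le_right _ _)).le
  -- the class-uniform tilt range `b` of the Lipschitz class at growth constant `C' + 1`
  obtain ⟨b, hb0, hWD⟩ := hWσ a₀ θ₀ u₀ ha hθ σ hσ hσ₀' Φ (C' + 1) (by positivity)
  -- the one-site Gaussian constants at growth `1`
  obtain ⟨t₁, ht₁, K₁, hK₁, hone⟩ := stub_oneSiteGauss hθ u₀ zero_le_one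
  refine ⟨min (b / 2) (t₁ / 2), lt_min (half_pos hb0) (half_pos ht₁), ?_⟩
  intro G hG hGC hGs hG0 hG1 hG2 β hβ ε hε
  have hβb : |2 * β| ≤ b := by
    rw [abs_mul, abs_two]; linarith [hβ.trans (min_le_left _ _)]
  have hβt : |2 * β| ≤ t₁ := by
    rw [abs_mul, abs_two]; linarith [hβ.trans (min_le_right _ _)]
  -- the accuracy `δ` of the Lipschitz approximation
  set δ : ℝ := min 1 (ε / (2 * (4 * K₁ * β ^ 2 + 1))) with hδdef
  have hδ : 0 < δ := lt_min one_pos (by positivity)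
  have hδ1 : δ ≤ 1 := min_le_left _ _
  have hδε : δ ≤ ε / (2 * (4 * K₁ * β ^ 2 + 1)) := min_le_right _ _
  have ht : |2 * β * δ| ≤ t₁ := by
    rw [abs_mul, abs_of_pos hδ]
    nlinarith [abs_nonneg (2 * β)]
  have hKε : K₁ * δ ^ 2 * (2 * β) ^ 2 ≤ ε / 2 := by
    rw [le_div_iff₀ (by positivity)] at hδε
    have hδsq : δ ^ 2 ≤ δ := by nlinarith
    have h4 : 0 ≤ 4 * K₁ * β ^ 2 := by positivity
    nlinarith [mul_le_mul_of_nonneg_left hδsq h4]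
  -- the Lipschitz dual family to `1, v_j, |v|²` and the Lipschitz approximation `G'` of `G`
  obtain ⟨e, he⟩ : ∃ e : Fin 5 → V3 → ℝ,
      e = ![fun _ => 1, fun v => v 0, fun v => v 1, fun v => v 2, fun v => ‖v‖ ^ 2] := ⟨_, rfl⟩
  obtain ⟨hec, heL, heind⟩ := invariants_props e he
  obtain ⟨ψ, hψc, hψs, hψL, hψB, hdual⟩ := lipschitzReduction_dualFamily hθ u₀ e hec heL heind
  have hGo : ∀ x l, ∫ v, G (x, v) * e l v * localMaxwellian 1 θ₀ u₀ v = 0 := fun x =>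
    (orth_iff e he (localMaxwellian 1 θ₀ u₀) (fun v => G (x, v))).2 ⟨hG0 x, hG1 x, hG2 x⟩
  obtain ⟨G', hG'c, hG's, ⟨L', hL'⟩, hG'o, hGG'⟩ := lipschitzReduction_approx hθ u₀ e hec ψ hψc
    ⟨2, hψs⟩ hψL hψB hdual hG hGs hGo δ hδ
  have hG'orth := fun x => (orth_iff e he (localMaxwellian 1 θ₀ u₀) (fun v => G' (x, v))).1 (hG'o x)
  have hG'0 : ∀ x, ∫ v, G' (x, v) * localMaxwellian 1 θ₀ u₀ v = 0 := fun x => (hG'orth x).1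
  have hG'1 : ∀ x (j : Fin 3), ∫ v, G' (x, v) * v j * localMaxwellian 1 θ₀ u₀ v = 0 :=
    fun x => (hG'orth x).2.1
  have hG'2 : ∀ x, ∫ v, G' (x, v) * ‖v‖ ^ 2 * localMaxwellian 1 θ₀ u₀ v = 0 :=
    fun x => (hG'orth x).2.2
  -- `G'` is in the Lipschitz class at growth constant `C' + 1`
  have hG'C : ∀ y, |G' y| ≤ (C' + 1) * (1 + ‖y.2‖ ^ 2) := fun y => by
    have h1 := hGC y
    have h2 := (hGG' y).trans hδ1
    have h3 : |G' y| ≤ |G y| + |G y - G' y| := by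
      have := abs_sub (G y) (G y - G' y); rwa [sub_sub_cancel] at this
    nlinarith [sq_nonneg ‖y.2‖]
  have hL0 : 0 ≤ max L' 0 := le_max_right _ _
  have hG'L : (∀ x v v', |G' (x, v) - G' (x, v')| ≤ max L' 0 * ‖v - v'‖ * (1 + ‖v‖ + ‖v'‖)) ∧
      (∀ x x' v, |G' (x, v) - G' (x', v)| ≤ max L' 0 * (1 + ‖v‖ ^ 2) * dist x x') := by
    refine ⟨fun x v v' => ?_, fun x x' v => ?_⟩
    · have h := (hL' (x, v) (x, v')).trans
        (mul_le_mul_of_nonneg_right (le_max_left L' 0) dist_nonneg)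
      have hd : dist (x, v) (x, v') = ‖v - v'‖ := by
        rw [Prod.dist_eq, dist_self, dist_eq_norm]; exact max_eq_right (norm_nonneg _)
      rw [hd] at h
      refine h.trans ?_
      have : 0 ≤ max L' 0 * ‖v - v'‖ := by positivity
      nlinarith [norm_nonneg v, norm_nonneg v']
    · have h := (hL' (x, v) (x', v)).trans
        (mul_le_mul_of_nonneg_right (le_max_left L' 0) dist_nonneg)
      have hd : dist (x, v) (x', v) = dist x x' := by
        rw [Prod.dist_eq, dist_self]; exact max_eq_left dist_nonneg
      rw [hd] at h
      refine h.trans ?_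
      have : 0 ≤ max L' 0 * dist x x' := by positivity
      nlinarith [sq_nonneg ‖v‖]
  -- the hypothesis for `G'` at tilt `2β`, tolerance `ε`
  obtain ⟨τ, hτ, N₀, hN⟩ := hWD G' hG'c hG'C hG's ⟨max L' 0, hG'L⟩ hG'0 hG'1 hG'2 (2 * β) hβb ε hε
  refine ⟨τ, hτ, N₀, fun N hNN => ?_⟩
  have hw : 0 < τ * ((N : ℝ) + 1) ^ (-(1 / 3 : ℝ)) :=
    mul_pos hτ (Real.rpow_pos_of_pos (by positivity) _)
  -- the remainder `G - G'` is uniformly small and centred: static bound at every window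
  have hTc : Continuous fun y : T3 × V3 => G y - G' y := hG.sub hG'c
  obtain ⟨R, hR⟩ := hGs
  obtain ⟨R', hR'⟩ := hG's
  have honeT : ∀ x : T3, ∫⁻ v, ENNReal.ofReal (Real.exp (2 * β * (G (x, v) - G' (x, v))))
      ∂(gaussMeasure u₀ θ₀) ≤ ENNReal.ofReal (Real.exp (K₁ * δ ^ 2 * (2 * β) ^ 2)) := by
    intro x
    have hTx : Continuous fun v : V3 => G (x, v) - G' (x, v) :=
      hTc.comp (Continuous.prodMk_right x)
    have hmeas : Measurable fun v : V3 => (G (x, v) - G' (x, v)) / δ :=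
      hTx.measurable.div_const δ
    have hgrowth : ∀ v : V3, |(G (x, v) - G' (x, v)) / δ| ≤ 1 * (1 + ‖v‖ ^ 2) := by
      intro v
      rw [abs_div, abs_of_pos hδ, div_le_iff₀ hδ, one_mul]
      calc |G (x, v) - G' (x, v)| ≤ δ := hGG' (x, v)
        _ ≤ (1 + ‖v‖ ^ 2) * δ := le_mul_of_one_le_left hδ.le (by nlinarith [sq_nonneg ‖v‖])
    have hIG : Integrable (fun v => G (x, v) * localMaxwellian 1 θ₀ u₀ v) :=
      integrable_of_vanish_ball ((hG.comp (Continuous.prodMk_right x)).mul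
        (continuous_localMaxwellian 1 θ₀ u₀)) R fun v hv => by rw [hR (x, v) hv, zero_mul]
    have hIG' : Integrable (fun v => G' (x, v) * localMaxwellian 1 θ₀ u₀ v) :=
      integrable_of_vanish_ball ((hG'c.comp (Continuous.prodMk_right x)).mul
        (continuous_localMaxwellian 1 θ₀ u₀)) R' fun v hv => by rw [hR' (x, v) hv, zero_mul]
    have hcent : ∫ v, (G (x, v) - G' (x, v)) / δ * localMaxwellian 1 θ₀ u₀ v = 0 := by
      have e1 : (fun v : V3 => (G (x, v) - G' (x, v)) / δ * localMaxwellian 1 θ₀ u₀ v) =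
          fun v => δ⁻¹ * (G (x, v) * localMaxwellian 1 θ₀ u₀ v -
            G' (x, v) * localMaxwellian 1 θ₀ u₀ v) := by
        funext v; ring
      rw [e1, integral_const_mul, integral_sub hIG hIG', hG0 x, hG'0 x, sub_zero, mul_zero]
    have key := hone _ hmeas hgrowth hcent (2 * β * δ) ht
    have e1 : ∀ v : V3, 2 * β * (G (x, v) - G' (x, v)) =
        2 * β * δ * ((G (x, v) - G' (x, v)) / δ) := fun v => by
      field_simp
    have e2 : K₁ * δ ^ 2 * (2 * β) ^ 2 = K₁ * (2 * β * δ) ^ 2 := by ring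
    simp_rw [e1]
    rw [e2]
    exact key
  have hTstat : ∫⁻ z, ENNReal.ofReal (Real.exp (2 * β * ∑ i : Fin (N + 1),
      (τ * ((N : ℝ) + 1) ^ (-(1 / 3 : ℝ)))⁻¹ *
        ∫ r in (0 : ℝ)..(τ * ((N : ℝ) + 1) ^ (-(1 / 3 : ℝ))),
          (G (((Φ N).flow r z) i) - G' (((Φ N).flow r z) i))))
      ∂(localGibbsLaw σ (fun _ => a₀) (fun _ => u₀) (fun _ => θ₀) N (Φ N)) ≤
      ENNReal.ofReal (Real.exp (ε / 2 * ((N : ℝ) + 1))) := by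
    have h := stub_staticReduction (F := fun y : T3 × V3 => G y - G' y) ha hθ u₀ hσ2 N (Φ N) hTc
      (β := 2 * β) (K := K₁ * δ ^ 2) honeT hτ
    refine h.trans (ENNReal.ofReal_le_ofReal (Real.exp_le_exp.2 ?_))
    exact mul_le_mul_of_nonneg_right hKε (by positivity)
  -- split `G = G' + (G - G')` and Hölder with weight `1/2`
  have hsplit := stub_holderSplit σ a₀ θ₀ u₀ N (Φ N) (G := G') (T := fun y : T3 × V3 => G y - G' y)
    hG'c hTc β (ϑ := 1 / 2) (by norm_num) (by norm_num) hw
  simp only [add_sub_cancel] at hsplit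
  refine hsplit.trans ?_
  have eβ1 : β / (1 - 1 / 2) = 2 * β := by ring
  have eβ2 : β / (1 / 2) = 2 * β := by ring
  rw [eβ1, eβ2]
  refine (mul_le_mul' (rpow_le_ofReal_exp_mul (hN N hNN) (by norm_num))
    (rpow_le_ofReal_exp_mul hTstat (by norm_num))).trans ?_
  rw [← ENNReal.ofReal_mul (Real.exp_nonneg _), ← Real.exp_add]
  refine ENNReal.ofReal_le_ofReal (Real.exp_le_exp.2 ?_)
  have hN1 : (0 : ℝ) ≤ (N : ℝ) + 1 := by positivity
  nlinarith [mul_nonneg hε.le hN1]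

end Summit.AtomisticToContinuum.HydrodynamicLimit.Theorems.ClampedCorrectorBirth

end
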